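import Summits.Ventures.PercRepro.SixFourResidueThreeGenericHolds
import Summits.Ventures.PercRepro.SixFourResidueThreeBetaTableB
import Summits.Ventures.PercRepro.SixFourResidueThreeBetaTail
import Summits.Ventures.PercRepro.SixFourResidueThreePlaneLine
import Summits.Ventures.PercRepro.SixFourResidueTypeThreeSmallHolds

/-!
# PercRepro — C-025 at `(6,4)`: THEOREM 21′ — `TwentyOnePrime` holds (p2, gen 10)

`0 ≤ J₃(G)` for every rank-`4` set `G ⊆ E` of a simple matroid with at least `10` points, by the trichotomy of §21.18.1
at `t = 3` (the `g ≥ 10` twin of `J_three_nonneg_of_card_le_nine`): (α) generic — Theorem G₃ for every `g`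
(`J_three_nonneg_of_generic_all`); (β) a plane trace with `g − 1` or `g − 2` points — Proposition 21.5 / Theorem 21.6
at `t = 3` for every plane size (`J_three_nonneg_of_plane_add_one_all`, `J_three_nonneg_of_plane_add_two_all`: the
tables `ThreeBetaTable` / `ThreeBetaTableB` for `p ≤ 100`, p1's `ThreeBetaTail` (§21.20, `betaCert_tail`) for `p ≥ 101`);
(γ) every plane trace `≤ g − 3` — `g = 10` on the exact lists (`J_three_nonneg_of_planeLine_le_ten`), `g ≥ 11` by the
margin accounting (`J_three_nonneg_of_planeLine`).  Hence **`twentyOnePrime_holds : TwentyOnePrime`**, and with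
p3's `typeThreeClause_of_twentyOnePrime` the whole type-`3` clause of `SixFourResidue` (`typeThreeClause_holds`).
-/

namespace PercRepro.SixFour

open Finset ThmH

variable {α : Type*} [DecidableEq α] {M : Matroid α} [M.Finite] {G : Finset α}

/-- **Proposition 21.5 at `t = 3` for every plane size**: if `G ∖ P₀` is a single point, `0 ≤ J₃(G)`. -/
theorem J_three_nonneg_of_plane_add_one_all (hs : Simple M) (hG : G ⊆ gr M) {P₀ : Finset α} (hP₀ : P₀ ∈ planes M)
    (hcard : (P₀ ∩ G).card + 1 = G.card) : 0 ≤ J M G 3 := by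
  rcases Nat.lt_or_ge 100 (P₀ ∩ G).card with h | h
  · exact J_three_nonneg_of_plane_add_one_of_tail hs hG hP₀ hcard (by omega)
  · exact J_three_nonneg_of_plane_add_one_of_table hs hG hP₀ hcard h

/-- **Theorem 21.6 at `t = 3` for every plane size**: if `G ∖ P₀` is a pair, `0 ≤ J₃(G)`. -/
theorem J_three_nonneg_of_plane_add_two_all (hs : Simple M) (hG : G ⊆ gr M) (hr : M.eRk (G : Set α) = 4)
    {P₀ : Finset α} (hP₀ : P₀ ∈ planes M) (hcard : (P₀ ∩ G).card + 2 = G.card) : 0 ≤ J M G 3 := by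
  rcases Nat.lt_or_ge 100 (P₀ ∩ G).card with h | h
  · exact J_three_nonneg_of_plane_add_two_of_tail hs hG hr hP₀ hcard (by omega)
  · exact J_three_nonneg_of_plane_add_two_of_table hs hG hr hP₀ hcard h

/-- **Theorem 21′ (§21.17)**: `0 ≤ J₃(G)` for every rank-`4` set `G ⊆ E` of a simple matroid with `|G| ≥ 10`. -/
theorem J_three_nonneg_of_ten_le (hs : Simple M) (hG : G ⊆ gr M) (hr : M.eRk (G : Set α) = 4)
    (hg : 10 ≤ G.card) : 0 ≤ J M G 3 := by
  by_cases hgen : Generic M G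
  · exact J_three_nonneg_of_generic_all hs hG hr hgen (by omega)
  by_cases hbig : ∃ P ∈ planes M, G.card ≤ (P ∩ G).card + 2
  · obtain ⟨P, hP, hPc⟩ := hbig
    have hlt : (P ∩ G).card < G.card := by
      apply Finset.card_lt_card
      refine ⟨Finset.inter_subset_right, fun h => ?_⟩
      have hsub : G ⊆ P := fun z hz => (Finset.mem_inter.1 (h hz)).1
      have hle := M.eRk_mono (Finset.coe_subset.2 hsub)
      rw [hr, (mem_planes.1 hP).2.2] at hle
      have h43 : (4 : ℕ) ≤ 3 := by exact_mod_cast hle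
      omega
    rcases (show (P ∩ G).card + 1 = G.card ∨ (P ∩ G).card + 2 = G.card by omega) with h1 | h2
    · exact J_three_nonneg_of_plane_add_one_all hs hG hP h1
    · exact J_three_nonneg_of_plane_add_two_all hs hG hr hP h2
  · push Not at hbig
    have hpl : ∀ P ∈ planes M, (P ∩ G).card + 3 ≤ G.card := fun P hP => by have := hbig P hP; omega
    rcases Nat.lt_or_ge 10 G.card with h11 | h10
    · exact J_three_nonneg_of_planeLine hs hG hr hpl h11
    · exact J_three_nonneg_of_planeLine_le_ten hs hG hr hgen hpl (by omega) h10

/-- **`TwentyOnePrime` holds**: Theorem 21′ in the `Prop` form of `SixFourResidueClausesThree`. -/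
theorem twentyOnePrime_holds : TwentyOnePrime := by
  intro β _ M _ G hs hG hr hg
  exact J_three_nonneg_of_ten_le hs hG hr hg

/-- **The type-`3` clause of `SixFourResidue` holds**: `TypeThreeClause`, from the `g ≤ 9` clause and Theorem 21′. -/
theorem typeThreeClause_holds : TypeThreeClause :=
  typeThreeClause_of_twentyOnePrime twentyOnePrime_holds

end PercRepro.SixFour
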